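import Summits.AtomisticToContinuum.HydrodynamicLimit.Theses.RelayRaceLocality
import Summits.AtomisticToContinuum.HydrodynamicLimit.Theorems.RelayRaceLocalityNearConstantShortTimeHLMeansPinDefs
import Summits.AtomisticToContinuum.HydrodynamicLimit.Theorems.RelayRaceLocalityNearConstantShortTimeHLTiltDomination
import Summits.AtomisticToContinuum.HydrodynamicLimit.Theorems.RelayRaceLocalityNearConstantShortTimeHLMeansNecessary
import HarnessLib

/-!
# Crux `NearConstantShortTimeHL` (stmt-AtomisticToContinuum-12502), line `small-tilt-domination` — typed statements

Support file for the crux `…Theses.RelayRaceLocality.NearConstantShortTimeHL` (near-constant short-time hydrodynamic limit for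
general diameter/number families), line `small-tilt-domination` (skeleton `Cruxes/NearConstantShortTimeHL/Lines/small_tilt_domination.lean`,
planner-cruxplan-…-small-tilt-dominatio-0; skeleton v2 by lead prover-line-stmt-AtomisticToContinuum-12502-c2-0). It declares, VERBATIM
from the registered skeleton, the typed statements the line's open stubs are about, so that stub files can import ONE set of names
(the pattern of `…MeansPinDefs.lean`, which already holds `MeansConverge`, and of `…TiltDomination.lean`, which holds `TiltDomination`):

* `MomentumClosureTightnessUR` — S2 (K-stub): windowed weak-form MOMENTUM closure defects of the ball-averaged empirical fields
  (radius `n^{-1/4}`, speed cap `n^{1/24}` and packing cap `η₁` inside the event — the frame of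
  `SuperextensiveClosureCost.MomentumClosureCost`, stmt-14424) have probability `≤ e^{−c₀ n}` under the INVARIANT drifted Gibbs law
  of a general family, with ONE rate `c₀(M)` chosen before the reference state, `σ` and the defect size `δ` (open; delegated-grade);
* `EnergyClosureTightnessUR` — S3, the energy twin (frame of `EnergyClosureCost`, stmt-14426; open; delegated-grade);
* `TrueLawCaps` — S4: the a-priori caps along the TRUE law, pre-shock, general families (`MaxSpeedBoundPreShock` 9511 ∧
  `NoDenseInclusions` 14425 ∧ `EnergyCurrentTails` 9235 re-typed; open; delegated-grade);
* `GeneralFamilyStaticLLN` — S5a: the time-`0` law of large numbers of the canonical local Gibbs laws of an arbitrary continuous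
  positive activity profile along a general family, towards the continuous unit-mass density obtained by ACTIVITY INVERSION
  (statics; provable from `activity_inversion_continuous` + `GeneralFamilyConcentration`, both landed).

PROVED here (registered sub-goal): the ROUTING lemma of S5b, `meansConverge_of_nearConstantRelEntropy : NearConstantRelEntropy →
MeansConverge` — the Gronwall proves the Yau-form target `NearConstantRelEntropy` (relative entropy `o(n_N)` at the matched reference) and
the means follow through the landed `stub_entropyToLLN` (entropy inequality ⇒ LLN at `t`) and `meansConverge_of_nearConstantShortTimeHL`
(LLN + uniform second moments ⇒ means). The line's remaining dynamics stub is `stub_meanFieldGronwall : GeneralFamilyStaticLLN →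
TiltDomination → MomentumClosureTightnessUR → EnergyClosureTightnessUR → TrueLawCaps → MeansConverge`; with `stub_smallTiltDomination :
TiltDomination` (landed), the dock `nearConstantRelEntropy_of_meansConverge` + the two landed statics stubs, and `stub_entropyToLLN`
(landed) it concludes the crux. References: H.-T. Yau, Lett. Math. Phys. 22 (1991) §2; H. Spohn, Large Scale Dynamics of Interacting Particles
(1991) Part I §3, Part II §7.1; E. Pulvirenti – D. Tsagkarogiannis, Comm. Math. Phys. 316 (2012) Thm 2.1.
-/

noncomputable section

namespace Summit.AtomisticToContinuum.HydrodynamicLimit.Theorems.NearConstantShortTimeHL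

open scoped BigOperators ENNReal
open MeasureTheory Set Filter
open Literature.MathematicalPhysics.KineticTheory Literature.Analysis.FluidPDE Literature.Analysis.FunctionSpaces

/-- **K-stub (momentum row) — CLOSURE TIGHTNESS AT A UNIFORM RATE under the invariant drifted Gibbs law, general
families.** The frame of `SuperextensiveClosureCost.MomentumClosureCost` (stmt-14424: ball averages at radius
`n^{-1/4}`, speed cap `n^{1/24}` and packing cap `η₁` INSIDE the event, smooth vector tests `ψ` normalised in `C¹`
on the window, windows inside `[0,1]`) with (i) the conjunct family replaced by a general family `(ε_N, n_N)`,
(ii) the reference `localGibbsLaw σ 1 0 θe` replaced by the drifted constant profile `(ā, ū, θe)` in the `M`-box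
(still invariant), and (iii) the superexponential `∀ M` replaced by ONE rate `c₀ > 0` chosen after `M` and BEFORE
`(ā, θe, ū, σ, ψ, δ)` — uniform in the defect size `δ` (the near-jump). Implied by the `∀ M`-form for general
families; in substance the same bet (a finite-cost localized sustained non-LTE defect below both caps kills both).
Cheap witnesses die on the macroscopic window: sub-`ℓ_n` shear/sound/thermal patterns cost `∝` defect but decay in
`≤ n^{-1/6} ≪ τ`; hot-particle bursts inside the speed cap thermalise in `n^{-3/8}`; thin dense rafts have
stress × lifetime `→ 0` (triage r1-2; this file's header). -/
@[conjecture] def MomentumClosureTightnessUR : Prop :=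
  ∃ η₁ : ℝ, 0 < η₁ ∧ ∀ M : ℝ, 1 ≤ M → ∃ c₀ : ℝ, 0 < c₀ ∧ ∀ (abar θe : ℝ) (ubar : V3),
    M⁻¹ ≤ abar → abar ≤ M → M⁻¹ ≤ θe → θe ≤ M → ‖ubar‖ ≤ M →
    ∃ σ₀ : ℝ, 0 < σ₀ ∧ ∀ σ : ℝ, 0 < σ → σ < σ₀ →
    ∀ (ε : ℕ → ℝ) (n : ℕ → ℕ), (∀ N, 0 < ε N) → Tendsto ε atTop (nhds 0) →
    Tendsto (fun N => (n N : ℝ) * ε N ^ 3) atTop (nhds (σ ^ 3)) →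
    ∀ Φ : (N : ℕ) → HardSphereFlow (Torus.geometry (Fin 3)) (ε N) (n N),
    ∀ (s τ : ℝ), 0 ≤ s → 0 < τ → s + τ ≤ 1 →
    ∀ ψ : ℝ → T3 → V3, Torus.IsSmoothSpaceTimeOn (Set.Icc s (s + τ)) ψ →
    (∀ r ∈ Set.Icc s (s + τ), ∀ x, ‖ψ r x‖ ≤ 1 ∧ ‖Torus.timeDerivWithin (Set.Icc s (s + τ)) ψ r x‖ ≤ 1 ∧
      ∀ i, ‖Torus.partialDeriv i (ψ r) x‖ ≤ 1) →
    ∀ δ : ℝ, 0 < δ → ∀ᶠ N : ℕ in atTop,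
      particleLaw (Φ N) (canonicalDensity (Torus.geometry (Fin 3)) (ε N) (n N)
          (localGibbsProfile (fun _ => abar) (fun _ => ubar) (fun _ => θe)))
        {z | let ℓ : ℝ := (n N : ℝ) ^ (-(1 / 4 : ℝ));
             let χ : T3 → T3 → ℝ := fun x y => if Torus.euclidDist x y < ℓ then (4 / 3 * Real.pi * ℓ ^ 3)⁻¹ else 0;
             let ρ : ℝ → T3 → ℝ := fun r x => empiricalDensityField ((Φ N).flow r z) (χ x);
             let m : ℝ → T3 → V3 := fun r x => empiricalMomentumField ((Φ N).flow r z) (χ x);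
             let e : ℝ → T3 → ℝ := fun r x => empiricalEnergyField ((Φ N).flow r z) (χ x);
             let p : ℝ → T3 → ℝ := fun r x => hsPressure σ (ρ r x) (2 / 3 * (e r x / ρ r x - ‖m r x‖ ^ 2 / (2 * ρ r x ^ 2)));
             let Mt : ℝ → (T3 → V3) → ℝ := fun r g => ∑ j, (empiricalMomentumField ((Φ N).flow r z) (fun y => g y j)) j;
             (∀ r ∈ Set.Icc s (s + τ), ∀ i, ‖((Φ N).flow r z i).2‖ ≤ (n N : ℝ) ^ (1 / 24 : ℝ)) ∧
             (∀ r ∈ Set.Icc s (s + τ), ∀ x, ρ r x * σ ^ 3 ≤ η₁) ∧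
             δ < |Mt (s + τ) (ψ (s + τ)) - Mt s (ψ s) - ∫ r in s..(s + τ),
               (Mt r (Torus.timeDerivWithin (Set.Icc s (s + τ)) ψ r) +
                ∫ x, ((∑ i, ∑ j, (Torus.partialDeriv i (ψ r) x) j * (m r x i * m r x j / ρ r x)) +
                  p r x * Torus.divergence (ψ r) x))|}
        ≤ ENNReal.ofReal (Real.exp (-(c₀ * n N)))

/-- **K-stub (energy row) — the ENERGY twin (triage sharpening r1-1/r1-2), frame of
`SuperextensiveClosureCost.EnergyClosureCost` (stmt-14426)** with the same three changes: general families, drifted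
reference in the `M`-box, ONE rate `c₀(M)` uniform in the defect size. The defect is the windowed weak-form energy
balance residual `⟨φ(s+τ), e_N(s+τ)⟩ − ⟨φ(s), e_N(s)⟩ − ∫_s^{s+τ}[⟨∂_rφ, e_N⟩ + ∫(e + p)(m/ρ)·∇φ dx]dr` with raw
empirical kinetic energy `e_N` and ball-averaged `(ρ, m, e, p)`; it contains the Euler heat-flux closure `q = 0`
at scales `≥ ℓ_n` and the CUBIC convective current, which is truncated INSIDE the event by the speed cap (one hot
sphere carries `≤ n^{1/8} ≪ δ n`; `δ n^{7/8}` hot spheres cost `δ n^{23/24}` statically but thermalise in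
`n^{-3/8}`, so the WINDOWED defect needs a sustained conspiracy — this is why the row is windowed and capped, cf.
the refutation of `EulerCharacteristics.ExpTailBudget`, stmt-14607). -/
@[conjecture] def EnergyClosureTightnessUR : Prop :=
  ∃ η₁ : ℝ, 0 < η₁ ∧ ∀ M : ℝ, 1 ≤ M → ∃ c₀ : ℝ, 0 < c₀ ∧ ∀ (abar θe : ℝ) (ubar : V3),
    M⁻¹ ≤ abar → abar ≤ M → M⁻¹ ≤ θe → θe ≤ M → ‖ubar‖ ≤ M →
    ∃ σ₀ : ℝ, 0 < σ₀ ∧ ∀ σ : ℝ, 0 < σ → σ < σ₀ →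
    ∀ (ε : ℕ → ℝ) (n : ℕ → ℕ), (∀ N, 0 < ε N) → Tendsto ε atTop (nhds 0) →
    Tendsto (fun N => (n N : ℝ) * ε N ^ 3) atTop (nhds (σ ^ 3)) →
    ∀ Φ : (N : ℕ) → HardSphereFlow (Torus.geometry (Fin 3)) (ε N) (n N),
    ∀ (s τ : ℝ), 0 ≤ s → 0 < τ → s + τ ≤ 1 →
    ∀ φ : ℝ → T3 → ℝ, Torus.IsSmoothSpaceTimeOn (Set.Icc s (s + τ)) φ →
    (∀ r ∈ Set.Icc s (s + τ), ∀ x, |φ r x| ≤ 1 ∧ |Torus.timeDerivWithin (Set.Icc s (s + τ)) φ r x| ≤ 1 ∧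
      ∀ i, |Torus.partialDeriv i (φ r) x| ≤ 1) →
    ∀ δ : ℝ, 0 < δ → ∀ᶠ N : ℕ in atTop,
      particleLaw (Φ N) (canonicalDensity (Torus.geometry (Fin 3)) (ε N) (n N)
          (localGibbsProfile (fun _ => abar) (fun _ => ubar) (fun _ => θe)))
        {z | let ℓ : ℝ := (n N : ℝ) ^ (-(1 / 4 : ℝ));
             let χ : T3 → T3 → ℝ := fun x y => if Torus.euclidDist x y < ℓ then (4 / 3 * Real.pi * ℓ ^ 3)⁻¹ else 0;
             let ρ : ℝ → T3 → ℝ := fun r x => empiricalDensityField ((Φ N).flow r z) (χ x);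
             let m : ℝ → T3 → V3 := fun r x => empiricalMomentumField ((Φ N).flow r z) (χ x);
             let e : ℝ → T3 → ℝ := fun r x => empiricalEnergyField ((Φ N).flow r z) (χ x);
             let p : ℝ → T3 → ℝ := fun r x => hsPressure σ (ρ r x) (2 / 3 * (e r x / ρ r x - ‖m r x‖ ^ 2 / (2 * ρ r x ^ 2)));
             let Et : ℝ → (T3 → ℝ) → ℝ := fun r g => empiricalEnergyField ((Φ N).flow r z) g;
             (∀ r ∈ Set.Icc s (s + τ), ∀ i, ‖((Φ N).flow r z i).2‖ ≤ (n N : ℝ) ^ (1 / 24 : ℝ)) ∧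
             (∀ r ∈ Set.Icc s (s + τ), ∀ x, ρ r x * σ ^ 3 ≤ η₁) ∧
             δ < |Et (s + τ) (φ (s + τ)) - Et s (φ s) - ∫ r in s..(s + τ),
               (Et r (Torus.timeDerivWithin (Set.Icc s (s + τ)) φ r) +
                ∫ x, (e r x + p r x) * (∑ i, (m r x i / ρ r x) * (Torus.gradient (φ r) x) i))|}
        ≤ ENNReal.ofReal (Real.exp (-(c₀ * n N)))

/-- **A-PRIORI CAPS ALONG THE TRUE LAW, general families (DELEGATED).** For every packing-cap level `η₁ > 0`, all
continuous positive profiles, `σ` small, every admissible family, every classical hs-Euler solution on `[0,T)` and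
every family of flows whose canonical local Gibbs laws are probability measures tied to the Euler data at `t = 0`:
for each `t < T` at which the nominal packing stays `≤ η₁/2` on `[0,t]`, (a) the SPEED CAP `n^{1/24}` fails somewhere
on `[0,t]` with probability `→ 0` (`MaxSpeedBoundPreShock`, stmt-9511), (b) the BALL-PACKING CAP `η₁` at radius
`n^{-1/4}` fails somewhere on `[0,t]` with probability `→ 0` (`NoDenseInclusions`, stmt-14425), (c) the CUBIC energy
current is uniformly integrable along the flow (`EnergyCurrentTails`, stmt-9235) — the three a-priori inputs of every
Yau-family line, here only re-typed for `(ε_N, n_N)` and nothing else (no near-constancy is assumed: they are believed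
pre-shock). Not transferable from equilibrium (sub-extensive costs); `HighMomentumCutoffBarrierNarrow` OPEN. -/
@[conjecture] def TrueLawCaps : Prop :=
  ∀ η₁ : ℝ, 0 < η₁ → ∀ (a₀ θ₀ : T3 → ℝ) (u₀ : T3 → V3), Continuous a₀ → Continuous θ₀ → Continuous u₀ →
    (∀ x, 0 < a₀ x) → (∀ x, 0 < θ₀ x) → ∃ σ₀ : ℝ, 0 < σ₀ ∧ ∀ σ : ℝ, 0 < σ → σ < σ₀ →
    ∀ (ε : ℕ → ℝ) (n : ℕ → ℕ), (∀ N, 0 < ε N) → Tendsto ε atTop (nhds 0) →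
    Tendsto (fun N => (n N : ℝ) * ε N ^ 3) atTop (nhds (σ ^ 3)) →
    ∀ (T : ℝ) (ρ θ : ℝ → T3 → ℝ) (u : ℝ → T3 → V3), IsHardSphereEulerSolution σ T ρ u θ →
    ∀ Φ : (N : ℕ) → HardSphereFlow (Torus.geometry (Fin 3)) (ε N) (n N),
    let P : (N : ℕ) → Measure (Config (n N) (Fin 3) T3) := fun N =>
      particleLaw (Φ N) (canonicalDensity (Torus.geometry (Fin 3)) (ε N) (n N) (localGibbsProfile a₀ u₀ θ₀));
    (∀ N, IsProbabilityMeasure (P N)) →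
    (∀ χ : T3 → ℝ, Continuous χ → ∀ δ : ℝ, 0 < δ →
      Tendsto (fun N => P N {z | δ < |empiricalDensityField ((Φ N).flow 0 z) χ - ∫ x, χ x * ρ 0 x|}) atTop (nhds 0) ∧
      Tendsto (fun N => P N {z | δ < ‖empiricalMomentumField ((Φ N).flow 0 z) χ - ∫ x, (χ x * ρ 0 x) • u 0 x‖}) atTop (nhds 0) ∧
      Tendsto (fun N => P N {z | δ < |empiricalEnergyField ((Φ N).flow 0 z) χ -
        ∫ x, χ x * totalEnergyDensity (ρ 0 x) (u 0 x) (θ 0 x)|}) atTop (nhds 0)) →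
    ∀ t ∈ Set.Ico 0 T, (∀ s ∈ Set.Icc 0 t, ∀ x, ρ s x * σ ^ 3 ≤ η₁ / 2) →
      Tendsto (fun N => P N {z | ∃ r ∈ Set.Icc 0 t, ∃ i, (n N : ℝ) ^ (1 / 24 : ℝ) < ‖((Φ N).flow r z i).2‖})
        atTop (nhds 0) ∧
      Tendsto (fun N => P N {z | ∃ r ∈ Set.Icc 0 t, ∃ x : T3,
        η₁ < empiricalDensityField ((Φ N).flow r z)
          (fun y => if Torus.euclidDist x y < (n N : ℝ) ^ (-(1 / 4 : ℝ))
            then (4 / 3 * Real.pi * ((n N : ℝ) ^ (-(1 / 4 : ℝ))) ^ 3)⁻¹ else 0) * σ ^ 3}) atTop (nhds 0) ∧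
      (∀ e : ℝ, 0 < e → ∃ K : ℝ, ∀ᶠ N : ℕ in atTop, ∀ s ∈ Set.Icc 0 t,
        ∫⁻ z, ENNReal.ofReal ((n N : ℝ)⁻¹ * ∑ i : Fin (n N),
          Set.indicator {v : V3 | K < ‖v‖} (fun v => ‖v‖ ^ 3) (((Φ N).flow s z i).2)) ∂(P N) ≤ ENNReal.ofReal e)

/-- **S5a statement — STATIC LAW OF LARGE NUMBERS AT TIME ZERO WITH ACTIVITY INVERSION, GENERAL FAMILIES** (the statics
that `stub_meanFieldGronwall` consumes at `t = 0`; shared need of every line on this crux — tilt-radius `stub_tieInversion`).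
For all continuous profiles `a₀, θ₀ > 0`, `u₀` there is `σ₀ > 0` (depending on the profile, as in the crux) such that for
`0 < σ < σ₀`: the activity is INVERTED, `a₀ = e^c · ρa · e^{g_σ(ρa)}` with `ρa` CONTINUOUS, positive, of unit mass
(`g_σ(r) = f_ex(rσ³) + rσ³ f_ex′(rσ³)` the local excess chemical potential; `activity_inversion_continuous`), and along EVERY
admissible family `(ε_N → 0, n_N ε_N³ → σ³)` and all flows, whenever the canonical local Gibbs laws `P_N` of `(a₀, u₀, θ₀)` are
probability measures, the three empirical fields at flow-time `0` satisfy the law of large numbers towards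
`(∫χρa, ∫χρa u₀, ∫χE(ρa, u₀, θ₀))` for every continuous `χ` (the constant `e^c` drops out of the canonical law,
`canonicalDensity_const_mul`; `P_N` is then the matched law of `(ρa, u₀, θ₀)` and `GeneralFamilyConcentration` (LANDED,
`stub_concentrationGeneralFamilies`) gives exponential concentration, `n_N → ∞`; `Φ₀ = id` a.s., `measure_setOf_flow_zero_mem`).
With the crux's tie and `profiles_eq_of_tendsto` this identifies `(ρa, u₀, θ₀) = (ρ, u, θ)(0)`. [cite: PulvirentiTsagkarogiannis2012, Thm 2.1] -/
@[conjecture] def GeneralFamilyStaticLLN : Prop :=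
  ∀ (a₀ θ₀ : T3 → ℝ) (u₀ : T3 → V3), Continuous a₀ → Continuous θ₀ → Continuous u₀ →
    (∀ x, 0 < a₀ x) → (∀ x, 0 < θ₀ x) → ∃ σ₀ : ℝ, 0 < σ₀ ∧ ∀ σ : ℝ, 0 < σ → σ < σ₀ →
    ∃ ρa : T3 → ℝ, Continuous ρa ∧ (∀ x, 0 < ρa x) ∧ (∫ x, ρa x) = 1 ∧
    (∃ c : ℝ, ∀ x, a₀ x = Real.exp c * ρa x *
      Real.exp (hsExcessFreeEnergy (ρa x * σ ^ 3) + ρa x * σ ^ 3 * deriv hsExcessFreeEnergy (ρa x * σ ^ 3))) ∧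
    ∀ (ε : ℕ → ℝ) (n : ℕ → ℕ), (∀ N, 0 < ε N) → Tendsto ε atTop (nhds 0) →
    Tendsto (fun N => (n N : ℝ) * ε N ^ 3) atTop (nhds (σ ^ 3)) →
    ∀ Φ : (N : ℕ) → HardSphereFlow (Torus.geometry (Fin 3)) (ε N) (n N),
    let P : (N : ℕ) → Measure (Config (n N) (Fin 3) T3) := fun N =>
      particleLaw (Φ N) (canonicalDensity (Torus.geometry (Fin 3)) (ε N) (n N) (localGibbsProfile a₀ u₀ θ₀));
    (∀ N, IsProbabilityMeasure (P N)) →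
    ∀ χ : T3 → ℝ, Continuous χ → ∀ δ : ℝ, 0 < δ →
      Tendsto (fun N => P N {z | δ < |empiricalDensityField ((Φ N).flow 0 z) χ - ∫ x, χ x * ρa x|}) atTop (nhds 0) ∧
      Tendsto (fun N => P N {z | δ < ‖empiricalMomentumField ((Φ N).flow 0 z) χ - ∫ x, (χ x * ρa x) • u₀ x‖})
        atTop (nhds 0) ∧
      Tendsto (fun N => P N {z | δ < |empiricalEnergyField ((Φ N).flow 0 z) χ -
        ∫ x, χ x * totalEnergyDensity (ρa x) (u₀ x) (θ₀ x)|}) atTop (nhds 0)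

/-! ## The routing lemma of S5b, proved from the tree -/

/-- **ROUTING (S5b)**: the Yau-form target implies convergence of the means — `stub_entropyToLLN` (relative entropy `o(n_N)` against
an exponentially concentrating reference ⇒ LLN at `t`, landed) followed by `meansConverge_of_nearConstantShortTimeHL` (LLN at `t` +
uniform second moments from energy conservation ⇒ convergence of the means, landed). So the Gronwall `stub_meanFieldGronwall` may (and
will) conclude `NearConstantRelEntropy`. [cite: Yau1991, §2] -/
theorem meansConverge_of_nearConstantRelEntropy : NearConstantRelEntropy → MeansConverge :=
  fun h => meansConverge_of_nearConstantShortTimeHL (stub_entropyToLLN h)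

end Summit.AtomisticToContinuum.HydrodynamicLimit.Theorems.NearConstantShortTimeHL

end
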